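import Summits.CriticalPhenomena.CardyFormulaZ2.Theses.CardyUSTContinuation
import Summits.CriticalPhenomena.CardyFormulaZ2.Theorems.CardyUSTContinuationUniformAnalyticExtensionStubRatioToCrux
import Summits.CriticalPhenomena.CardyFormulaZ2.Theorems.CardyUSTContinuationUniformAnalyticExtensionDerivativeBounds
import Summits.CriticalPhenomena.CardyFormulaZ2.Theorems.CardyUSTContinuationUniformAnalyticExtensionTightness
import Summits.CriticalPhenomena.CardyFormulaZ2.Theorems.CardyUSTContinuationUniformAnalyticExtensionStubDerivBoundsToRatioBound
import Literature.Probability.LatticeModels.FKTwoArcPartitionPolynomials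
import HarnessLib.Audit

/-!
# Skeleton v8.1 for the crux `UniformAnalyticExtension` (line `registered` = birth; v8/v8.1 by lead c7)
(item stmt-CriticalPhenomena-6047, rank-2 crux of route `CardyUSTContinuation`, sub-problem
`CardyFormulaZ2`; v2 lead c1, v3 lead c2, v4 lead c3, v5/v6 lead c4, v7 lead c6, v8 2026-08-17 by
`prover-line-stmt-CriticalPhenomena-6047-c7-0`)

The crux (`Summit.CriticalPhenomena.CardyFormulaZ2.Theses.CardyUSTContinuation.UniformAnalyticExtension`):
for every conformal rectangle `R` and `t₁ ∈ (0,1)` there are `ρ > 0`, `M` such that, eventually as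
`δ → 0⁺`, the jointly-wired self-dual FK crossing probability `t ↦ u_R(t, δ)` on `[t₁, 1]` is the
restriction of a function analytic on the complex `ρ`-neighbourhood `U_ρ` of `S = [t₁, 1] ⊂ ℂ` and
bounded there by `M`.  In-tree reduction (Literature, proved): for `δ > 0`, `t > 0`,
`u_R(t, δ) = N_δ(t) / Z_δ(t)` with `Z_δ = fkTwoArcPartitionPolynomials R δ .joint`,
`N_δ = fkTwoArcCrossingPolynomial R δ .joint ∈ ℕ[X]`, `N_δ ≤ Z_δ` coefficientwise; write
`f_δ z = N_δ(z)/Z_δ(z)` for the junk-valued rational function on `ℂ` (holomorphic near every real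
`t > 0`, where `Z_δ(t) > 0`).

## v8: the REAL-AXIS cut — one physical stub, UNCONDITIONALLY equivalent to the crux

v7 (lead c6) registered the value-distribution stub `stub_ratioOmits` ("`f_δ : U_ρ → ℂ ∖ {0,1}`
δ-uniformly"), which implies the crux by Schottky's theorem (landed) and follows from it GIVEN the
sibling crux X_S (p163530).  Lead c6 also landed the real-axis NECESSARY condition
`crux_derivBounds` (p163846): the crux gives δ-uniform Gevrey-1 bounds
`‖f_δ^{(k)}(t)‖ ≤ M · k!/rᵏ` for all orders `k`, all `t ∈ [t₁, 1]`, all small `δ` (Cauchy).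
v8 registers THAT conclusion, verbatim, as the single physical stub and adds the converse engine:

* `stub_derivBounds` (PHYSICAL, open): the body of the conclusion of `crux_derivBounds`.  Along the
  self-dual line `(t∂_t)^k u_R(t,δ)` is the joint cumulant, under the critical FK measure, of the
  crossing indicator with `k` copies of `H(ω) = |ω| + 2k^joint(ω)` (number of loops + const); at
  `t = 1` these are cumulants under Bernoulli(1/2) bond percolation of `Ω_δ`.  So the stub reads:
  δ-uniform factorial bounds on all these cumulants, locally uniformly on `[t₁, 1]` — a statement on
  the REAL segment only, refutable by exact polynomials or by Monte Carlo (order 1 at `t = 1`: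
  `|Cov_δ(1_cross, H)| ≤ C`, lead c7's probe (P1)).
* `stub_derivBoundsToRatioBound` (ENGINE, LANDED p167276 by lead c7's stub-worker, imported): Gevrey-1 bounds at the real points
  ⇒ the normal form `ratioBound` with `ρ = r/2`, bound `2·max M 0`: the Taylor series of `f_δ` at
  `t ∈ [t₁,1]` has radius `≥ r` (coefficient bounds), sums to a holomorphic `F_t` on `ball t r` with
  `‖F_t‖ ≤ 2M` on `ball t (r/2)`, `F_t = f_δ` near `t` (`Complex.hasSum_taylorSeries_on_ball`), hence
  `F_t · Z_δ = N_δ` on the ball (identity theorem) and `f_δ = F_t` off the zeros of `Z_δ` (junk `0` at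
  the zeros).
* `stub_ratioToCrux` (NORMAL FORM ⇒ crux, LANDED p145290, imported).

Consequently (`derivBounds_iff_crux`, sorry-free in v8.1; landed twin `realAxis_crux_iff_derivBounds`,
p168437, `Theorems/…RealAxisTightness.lean`): `stub_derivBounds ↔ UniformAnalyticExtension`
with NO appeal to X_S — the crux is atomic with respect to complex-analytic (v2–v7) AND real-analytic
(v8) reductions; all of its content is the δ-uniformity, now stated on the real critical segment.
The v7 stub implies the v8 stub (`derivBounds_of_ratioOmits`, via the landed Schottky composition).
-/

noncomputable section

open Filter Topology Set Polynomial Metric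
open Literature.Probability.LatticeModels
open Literature.Probability.RandomPlanarGeometry (ConformalRectangle)

namespace Summit.CriticalPhenomena.CardyFormulaZ2.Cruxes.UniformAnalyticExtension.Birth

/-! ### Stub statements as named propositions (hypotheses of the composition, by name) -/

/-- Statement of `stub_derivBounds` (physical, the ONE open stub of v8): δ-uniform Gevrey-1 bounds
for the crossing ratio at the real points of `[t₁, 1]` — verbatim the conclusion of the landed
necessary condition `crux_derivBounds` (p163846). -/
def Sig.stub_derivBounds : Prop :=
  ∀ R : ConformalRectangle, ∀ t₁ ∈ Set.Ioo (0:ℝ) 1, ∃ r > (0:ℝ), ∃ M : ℝ, ∀ᶠ δ in 𝓝[>] (0:ℝ),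
    ∀ k : ℕ, ∀ t ∈ Set.Icc t₁ 1,
      ‖iteratedDeriv k (fun z : ℂ => aeval z (fkTwoArcCrossingPolynomial R δ ArcWiring.joint) /
          aeval z (fkTwoArcPartitionPolynomials R δ ArcWiring.joint)) (t : ℂ)‖ ≤
        M * k.factorial / r ^ k

/-- The NORMAL FORM of the crux (c1): a δ-uniform bound of the junk-valued crossing ratio
`N_δ/Z_δ` on a complex `ρ`-neighbourhood of `[t₁, 1]`. -/
def Sig.ratioBound : Prop :=
  ∀ R : ConformalRectangle, ∀ t₁ ∈ Set.Ioo (0:ℝ) 1, ∃ ρ > (0:ℝ), ∃ M : ℝ, ∀ᶠ δ in 𝓝[>] (0:ℝ),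
    ∀ z ∈ thickening ρ (((↑) : ℝ → ℂ) '' Set.Icc t₁ 1),
      ‖aeval z (fkTwoArcCrossingPolynomial R δ ArcWiring.joint) /
          aeval z (fkTwoArcPartitionPolynomials R δ ArcWiring.joint)‖ ≤ M

/-- Statement of `stub_derivBoundsToRatioBound` (engine: Gevrey bounds on the segment ⇒ the normal
form). -/
def Sig.stub_derivBoundsToRatioBound : Prop :=
  Sig.stub_derivBounds → Sig.ratioBound

/-- Statement of `stub_ratioToCrux` (normal form ⇒ crux; LANDED p145290).  The conclusion is the BODY
of the route decl `UniformAnalyticExtension` with its `let uJ := …` ζ/β-reduced. -/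
def Sig.stub_ratioToCrux : Prop :=
  (∀ R : ConformalRectangle, ∀ t₁ ∈ Set.Ioo (0:ℝ) 1, ∃ ρ > (0:ℝ), ∃ M : ℝ, ∀ᶠ δ in 𝓝[>] (0:ℝ),
    ∀ z ∈ thickening ρ (((↑) : ℝ → ℂ) '' Set.Icc t₁ 1),
      ‖aeval z (fkTwoArcCrossingPolynomial R δ ArcWiring.joint) /
          aeval z (fkTwoArcPartitionPolynomials R δ ArcWiring.joint)‖ ≤ M) →
    (∀ R : Literature.Probability.RandomPlanarGeometry.ConformalRectangle, ∀ t₁ ∈ Set.Ioo (0:ℝ) 1,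
        ∃ ρ > (0:ℝ), ∃ M : ℝ, ∀ᶠ δ in 𝓝[>] (0:ℝ), ∃ g : ℂ → ℂ,
          DifferentiableOn ℂ g (Metric.thickening ρ (((↑) : ℝ → ℂ) '' Set.Icc t₁ 1)) ∧
          (∀ z ∈ Metric.thickening ρ (((↑) : ℝ → ℂ) '' Set.Icc t₁ 1), ‖g z‖ ≤ M) ∧
          ∀ t ∈ Set.Icc t₁ 1, g t =
            ((if h : 0 < δ then (@Literature.Probability.LatticeModels.fkDomainMeasure R.carrier δ
                (t / (1 + t)) (t ^ 2) (R.arc 0 ∪ R.arc 2)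
                (Literature.Probability.LatticeModels.meshDomain_finite R.isBounded h).fintype).real
                (Literature.Probability.Percolation.discreteCrossing R.carrier δ (R.arc 0) (R.arc 2))
              else 0 : ℝ) : ℂ))

/-- Statement of the v7 stub `stub_ratioOmits` (value-distribution form; kept for comparison). -/
def Sig.stub_ratioOmits : Prop :=
  ∀ R : ConformalRectangle, ∀ t₁ ∈ Set.Ioo (0:ℝ) 1, ∃ ρ > (0:ℝ), ∀ᶠ δ in 𝓝[>] (0:ℝ),
    ∃ h : ℂ → ℂ, DifferentiableOn ℂ h (thickening ρ (((↑) : ℝ → ℂ) '' Set.Icc t₁ 1)) ∧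
      (∀ z ∈ thickening ρ (((↑) : ℝ → ℂ) '' Set.Icc t₁ 1), h z ≠ 0 ∧ h z ≠ 1) ∧
      ∀ z ∈ thickening ρ (((↑) : ℝ → ℂ) '' Set.Icc t₁ 1),
        aeval z (fkTwoArcCrossingPolynomial R δ ArcWiring.joint) =
          h z * aeval z (fkTwoArcPartitionPolynomials R δ ArcWiring.joint)

/-! ### The stubs -/

-- LANDED and imported: `stub_ratioToCrux` — p145290, `Theorems/…StubRatioToCrux.lean`.
example : Sig.stub_ratioToCrux := stub_ratioToCrux

-- LANDED and imported: `stub_derivBoundsToRatioBound` — p167276, `Theorems/…StubDerivBoundsToRatioBound.lean`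
--   (engine: Gevrey bounds at the real points ⇒ `ratioBound`, Taylor series + identity theorem).
example : Sig.stub_derivBoundsToRatioBound := stub_derivBoundsToRatioBound

/-- **stub_derivBounds** (PHYSICAL, open — the real-axis form of the Lee–Yang content of the crux):
for every conformal rectangle `R` and `t₁ ∈ (0,1)` there are `r > 0` and `M` such that for all
small `δ > 0`, every order `k` and every `t ∈ [t₁, 1]`, `‖(N_δ/Z_δ)^{(k)}(t)‖ ≤ M · k!/rᵏ`
(equivalently: δ-uniform factorial bounds on the joint cumulants of the crossing indicator with
`k` copies of `|ω| + 2k^joint(ω)` under the critical self-dual FK measure, locally uniformly in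
`t ∈ [t₁, 1]`). -/
theorem stub_derivBounds :
    ∀ R : ConformalRectangle, ∀ t₁ ∈ Set.Ioo (0:ℝ) 1, ∃ r > (0:ℝ), ∃ M : ℝ, ∀ᶠ δ in 𝓝[>] (0:ℝ),
      ∀ k : ℕ, ∀ t ∈ Set.Icc t₁ 1,
        ‖iteratedDeriv k (fun z : ℂ => aeval z (fkTwoArcCrossingPolynomial R δ ArcWiring.joint) /
            aeval z (fkTwoArcPartitionPolynomials R δ ArcWiring.joint)) (t : ℂ)‖ ≤
          M * k.factorial / r ^ k := by
  sorry

/-! ### Composition (sorry-free) and tightness -/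

/-- **Composition**: the engine, the one physical stub and the landed normal form give the crux BY
NAME. -/
theorem UniformAnalyticExtension_of :
    Sig.stub_derivBoundsToRatioBound → Sig.stub_derivBounds → Sig.stub_ratioToCrux →
      Summit.CriticalPhenomena.CardyFormulaZ2.Theses.CardyUSTContinuation.UniformAnalyticExtension :=
  fun hE hD hRC => hRC (hE hD)

/-- The crux term assembled from the (sorried) stubs — shows the registered stub signatures are
literally the hypotheses of `UniformAnalyticExtension_of`. -/
theorem uniformAnalyticExtension_proof :
    Summit.CriticalPhenomena.CardyFormulaZ2.Theses.CardyUSTContinuation.UniformAnalyticExtension :=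
  UniformAnalyticExtension_of stub_derivBoundsToRatioBound stub_derivBounds stub_ratioToCrux

/-- **crux ⇒ the stub** (LANDED content, p163846: Cauchy's inequalities for the bounded extension). -/
theorem stub_derivBounds_of_crux :
    Summit.CriticalPhenomena.CardyFormulaZ2.Theses.CardyUSTContinuation.UniformAnalyticExtension →
      Sig.stub_derivBounds :=
  crux_derivBounds

/-- **Tightness of the line, unconditional and sorry-free.** The one physical stub of v8 is
EQUIVALENT to the crux (no appeal to the sibling crux X_S, unlike v7's `stub_ratioOmits`):
`⇒` by the landed engine + normal form, `⇐` by the landed Cauchy estimates. -/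
theorem derivBounds_iff_crux :
    Sig.stub_derivBounds ↔
      Summit.CriticalPhenomena.CardyFormulaZ2.Theses.CardyUSTContinuation.UniformAnalyticExtension :=
  ⟨fun hD => UniformAnalyticExtension_of stub_derivBoundsToRatioBound hD stub_ratioToCrux,
    stub_derivBounds_of_crux⟩

/-- **v7 ⇒ v8**: the value-distribution stub of v7 implies the real-axis stub of v8 (Schottky
composition `tightness_crux_of_ratioOmits`, landed p163530, then `crux_derivBounds`). -/
theorem derivBounds_of_ratioOmits : Sig.stub_ratioOmits → Sig.stub_derivBounds :=
  fun hO => stub_derivBounds_of_crux (tightness_crux_of_ratioOmits hO)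

end Summit.CriticalPhenomena.CardyFormulaZ2.Cruxes.UniformAnalyticExtension.Birth
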